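import Mathlib.GroupTheory.SemidirectProduct
import Mathlib.GroupTheory.SpecificGroups.Cyclic.Basic
import Mathlib.GroupTheory.IndexNormal
import Literature.NumberTheory.GaloisRepresentations.ProjectiveTypeKleinAction
import HarnessLib

/-!
# Representations of Hessian `108`-type (projective image `3² : 4`)

Trunk GalRep (topic `NumberTheory/GaloisRepresentations`), companion to `ProjectiveType`
(projective image `Literature.NumberTheory.GaloisRepresentations.projectiveImage` and the five
Klein types of a two-dimensional representation), serving the route
`Summits/Langlands/Langlands/Theses/HessianFirstBlood` (strong Artin for three-dimensional
representations of "`108`-type"; ledger item `defn-IsHessian108Type`).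

Informal content.  Lapid (*Doc. Math.* 3 (1998), §5 "A generalized tetrahedral
representation") singles out, for a prime power `q`, the irreducible `q`-dimensional
representations whose image in `PGL_q(ℂ)` is isomorphic to `V ⋊ B`, `V = 𝔽_q²`,
`B ≤ SL₂(𝔽_q)` solvable with `q ∤ |B|`, as "the simplest representations for which Artin's
conjecture is not known" (loc. cit., Introduction and §5, Remark 3: for `q = 3`, `|B| = 2` the
representation is monomial and "no other cases seem to be known").  For `q = 3` and `B ≅ ℤ/4`
(a cyclic subgroup of order `4` of `SL₂(𝔽₃) ≅ 2.A₄`, generated by an element of order `4`, which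
acts on `𝔽₃²` as a quarter-turn: square `= -1`, no non-zero fixed vector) the projective image is
the Frobenius group `3² : 4 = 𝔽₃² ⋊ ℤ/4` of order `36` (SmallGroup(36,9)), and the linear image
of an irreducible `ρ : G → GL₃(ℂ)` of this kind in `SL₃(ℂ)` is Blichfeldt's primitive group of
order `108` — whence "`108`-type"; the two larger primitive solvable groups, of orders `216`
and `648`, have projective images `3² : Q₈` (order `72`) and `3² : SL₂(𝔽₃)` (order `216`, the
Hessian group of the nine inflexions, Coxeter–Moser §7.7).

The route inlines the notion through three intrinsic invariants of the projective image —
order `36`, trivial centre, an element of order `4` — and this file (1) defines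
`IsHessian108Type` in exactly that form, (2) proves that the three invariants characterise
`3² : 4` among all groups (recognition theorem `Hessian36.invariants_iff_nonempty_mulEquiv_model`:
among the `14` groups of order `36` only `3² : 4` and `S₃ × S₃` are centreless and `S₃ × S₃` has
no element of order `4`; proved here directly by Sylow theory, without the classification),
(3) proves the structural consequences used by the route (its support item `Order36Frobenius`
verbatim: `Hessian36.order36Frobenius`), and (4) proves invariance of the type under conjugation
and under the contragredient/dual.

## Contents (all proved; no named facts in this file)

* `Hessian36.order36Frobenius` — a finite group of order `36` with trivial centre and an element
  of order `4` has a normal subgroup `N` of order `9` and exponent `3`, all elements outside `N`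
  have order `2` or `4`, and no non-trivial element of `N` is centralised from outside `N`.
  Ingredients: `Hessian36.sylow_normal` (the Sylow `3`-subgroup is normal),
  `Hessian36.conj_sq_eq_inv` (the square of an element of order `4` inverts it),
  `Hessian36.pow_three_eq_one`, `Hessian36.orderOf_eq_two_or_four`,
  `Hessian36.eq_one_of_commute_of_not_mem`.
* `Hessian36.Model = Hessian36.V ⋊[Hessian36.rotHom] Hessian36.C4`, the semidirect product
  `Multiplicative (ZMod 3 × ZMod 3) ⋊ Multiplicative (ZMod 4)` through the quarter-turn
  `rot (a, b) = (-b, a)`; `Hessian36.card_model` (`= 36`), `Hessian36.center_model` (`= ⊥`),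
  `Hessian36.orderOf_inr_one` (`= 4`), `Hessian36.isSolvable_model`.
* `Hessian36.nonempty_mulEquiv_model`, `Hessian36.invariants_iff_nonempty_mulEquiv_model` — the
  recognition theorem and the characterisation "invariants ⇔ `≃* Model`".
* `glContragredient`, `pglContragredient`, `projectiveImageCompEquiv`,
  `projectiveImageContragredientEquiv` — functoriality of the projective image under
  `g ↦ (g⁻¹)ᵀ` (`toMonoidHom_glTransposeInv`: this is the map underlying `glTransposeInv` and
  `FramedRep.dual`).
* `IsHessian108Type ρ` (definition; `isHessian108Type_iff` is `Iff.rfl`),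
  `isHessian108Type_iff_nonempty_mulEquiv`, `IsHessian108Type.exists_normal_subgroup`,
  `IsHessian108Type.isSolvable_range`, `isHessian108Type_conjGL_iff`,
  `isHessian108Type_contragredient_iff`, `FramedRep.isHessian108Type_dual_iff`,
  `FramedRep.isHessian108Type_conj_iff`.
* Companions (definitions, with conjugation/contragredient invariance): the natural action
  `Hessian36.slAction : SL(2, ZMod 3) →* MulAut V` (`Hessian36.slAction_rotSL`: the quarter-turn
  of the `108`-model is the action of `rotSL = [[0,-1],[1,0]] ∈ SL₂(𝔽₃)`, of order `4`),
  `Hessian36.ModelSub B = V ⋊ B` for `B ≤ SL₂(𝔽₃)` and `Hessian36.Model648 = V ⋊ SL₂(𝔽₃)`;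
  `IsHessian216Type ρ` (projective image `≅ V ⋊ Q`, `Q` a Sylow `2`-subgroup `≅ Q₈` of
  `SL₂(𝔽₃)`: the group `3² : Q₈` of order `72`) and `IsHessian648Type ρ` (projective image
  `≅ V ⋊ SL₂(𝔽₃)`, order `216`).

## Mathlib search

Mathlib (this pin) has `SemidirectProduct` (`lift`, `card`, `equivProd`, `inl`/`inr`/`rightHom`,
`range_inl_eq_ker_rightHom`), Sylow theory (`Sylow.card_eq_multiplicity`,
`card_sylow_modEq_one`, `Sylow.card_dvd_index`, `Sylow.card_eq_index_normalizer`,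
`Sylow.normal_of_subsingleton`), `IsPGroup.isMulCommutative_of_card_eq_prime_sq`,
`Subgroup.normal_of_index_eq_two`, `Subgroup.normal_subgroupOf_iff_le_normalizer`,
`Matrix.ProjGenLinGroup` (`PGL(n, R)`, `lift`, `mk_scalar`, `induction_on`), `ZMod`,
`Multiplicative`; it has **no** catalogue of groups of order `36`, no `SmallGroup` library, no
recognition theorem for Frobenius groups, and no notion of projective image or of the types of
a three-dimensional representation (grep `Hessian`, `Frobenius group`, `Blichfeldt`,
`order 36`: nothing relevant).  The projective image and `conjGL`/`projectiveImageConjEquiv` are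
those of `ProjectiveType`/`ProjectiveTypeSolvable`; `KleinAction.card_sylow_of_card` is reused
from `ProjectiveTypeKleinAction`.  Nothing here duplicates a Mathlib declaration.

## References

* E. M. Lapid, *A note on the global Langlands conjecture*, Doc. Math. 3 (1998), 285–296,
  §5 and Remark 3 (read: pp. 7–8 of the EMS Press file). [Lapid1998]
* H. S. M. Coxeter, W. O. J. Moser, *Generators and Relations for Discrete Groups*, 4th ed.,
  Springer (1980), §7.7 "The Hessian group and LF(3,3)" (read: PDF p. 112 of the Springer
  file: "The 216 'direct' collineations form the Hessian group of order 216").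
* G. A. Miller, H. F. Blichfeldt, L. E. Dickson, *Theory and Applications of Finite Groups*
  (1916), Ch. XII (Blichfeldt's classification of the finite primitive subgroups of `SL₃(ℂ)`;
  the groups of orders `108`, `216`, `648`) — background for the name only, not used.
-/

open scoped MatrixGroups Matrix
open Subgroup

namespace Literature.NumberTheory.GaloisRepresentations

namespace Hessian36

/-! ### Part 1: finite groups of order `36` with trivial centre and an element of order `4` -/

section Arith

/-- `k² + 1` is never divisible by `3` (`-1` is not a square mod `3`). [folklore] -/
theorem not_three_dvd_sq_add_one (k : ℕ) : ¬ 3 ∣ k ^ 2 + 1 := by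
  rw [Nat.dvd_iff_mod_eq_zero, Nat.add_mod, Nat.pow_mod]
  have hk : k % 3 < 3 := Nat.mod_lt k (by norm_num)
  generalize k % 3 = m at hk ⊢
  interval_cases m <;> decide

/-- The divisors of `9`. [folklore] -/
theorem eq_of_dvd_nine {d : ℕ} (h : d ∣ 9) : d = 1 ∨ d = 3 ∨ d = 9 := by
  have h' : d ∣ 3 ^ 2 := by simpa using h
  obtain ⟨m, hm, rfl⟩ := (Nat.dvd_prime_pow Nat.prime_three).mp h'
  interval_cases m <;> simp

end Arith

section Conj

variable {H : Type*} [Group H]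

/-- If conjugation by `g` maps `y` to a power of `y` while conjugation by `g²` inverts `y`,
then `3 ∤ ord y` (because `k² ≢ -1 (mod 3)`). [folklore] -/
theorem not_three_dvd_orderOf {g y : H} (hk : g * y * g⁻¹ ∈ Submonoid.powers y)
    (hτ : g ^ 2 * y * (g ^ 2)⁻¹ = y⁻¹) : ¬ 3 ∣ orderOf y := by
  obtain ⟨k, hk⟩ := (Submonoid.mem_powers_iff _ _).mp hk
  intro h3
  have h1 : g ^ 2 * y * (g ^ 2)⁻¹ = y ^ (k ^ 2) := by
    calc g ^ 2 * y * (g ^ 2)⁻¹ = g * (g * y * g⁻¹) * g⁻¹ := by rw [sq]; group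
      _ = g * y ^ k * g⁻¹ := by rw [← hk]
      _ = (g * y * g⁻¹) ^ k := conj_pow.symm
      _ = (y ^ k) ^ k := by rw [← hk]
      _ = y ^ (k ^ 2) := by rw [← pow_mul, sq]
  have h2 : y ^ (k ^ 2 + 1) = 1 := by rw [pow_succ, ← h1, hτ, inv_mul_cancel]
  exact not_three_dvd_sq_add_one k (h3.trans (orderOf_dvd_of_pow_eq_one h2))

/-- For an involutive conjugation `x ↦ c x c⁻¹` (`c² = 1`), the element `x (c x c⁻¹)⁻¹` is
inverted by it. [folklore] -/
theorem conj_mul_conj_inv_eq_inv {c x : H} (hc : c * c = 1) :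
    c * (x * (c * x * c⁻¹)⁻¹) * c⁻¹ = (x * (c * x * c⁻¹)⁻¹)⁻¹ := by
  have hcinv : c⁻¹ = c := inv_eq_of_mul_eq_one_right hc
  simp only [hcinv, mul_inv_rev, inv_inv, mul_assoc, hc, mul_one]

/-- The elements of a commutative subgroup `P` inverted by conjugation by `c` form a subgroup.
[folklore] -/
def invertedBy (P : Subgroup H) (hP : ∀ a ∈ P, ∀ b ∈ P, a * b = b * a) (c : H) :
    Subgroup H where
  carrier := {x | x ∈ P ∧ c * x * c⁻¹ = x⁻¹}
  one_mem' := ⟨P.one_mem, by simp⟩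
  mul_mem' := by
    rintro x y ⟨hx, hx'⟩ ⟨hy, hy'⟩
    refine ⟨P.mul_mem hx hy, ?_⟩
    calc c * (x * y) * c⁻¹ = (c * x * c⁻¹) * (c * y * c⁻¹) := by group
      _ = x⁻¹ * y⁻¹ := by rw [hx', hy']
      _ = (y * x)⁻¹ := (mul_inv_rev y x).symm
      _ = (x * y)⁻¹ := by rw [hP x hx y hy]
  inv_mem' := by
    rintro x ⟨hx, hx'⟩
    refine ⟨P.inv_mem hx, ?_⟩
    calc c * x⁻¹ * c⁻¹ = (c * x * c⁻¹)⁻¹ := by group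
      _ = (x⁻¹)⁻¹ := by rw [hx']

/-- Membership in `invertedBy` (definitional unfolding). [folklore] -/
theorem mem_invertedBy {P : Subgroup H} {hP : ∀ a ∈ P, ∀ b ∈ P, a * b = b * a} {c x : H} :
    x ∈ invertedBy P hP c ↔ x ∈ P ∧ c * x * c⁻¹ = x⁻¹ :=
  Iff.rfl

/-- `invertedBy P hP c ≤ P`. [folklore] -/
theorem invertedBy_le (P : Subgroup H) (hP : ∀ a ∈ P, ∀ b ∈ P, a * b = b * a) (c : H) :
    invertedBy P hP c ≤ P := fun _ h => h.1

end Conj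

section Order36

variable {H : Type*} [Group H] [Finite H]

/-- In a group of order `36` a Sylow `3`-subgroup has order `9`. [folklore] -/
theorem card_sylow (h36 : Nat.card H = 36) (P : Sylow 3 H) : Nat.card (P : Subgroup H) = 9 :=
  KleinAction.card_sylow_of_card P 2 4 (by rw [h36]; norm_num) (by norm_num)

/-- In a group of order `36` a Sylow `3`-subgroup has index `4`. [folklore] -/
theorem index_sylow (h36 : Nat.card H = 36) (P : Sylow 3 H) : (P : Subgroup H).index = 4 := by
  have := (P : Subgroup H).index_mul_card
  rw [card_sylow h36 P, h36] at this
  omega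

/-- A Sylow `3`-subgroup of a group of order `36` (order `9 = 3²`) is commutative. [folklore] -/
theorem sylow_comm (h36 : Nat.card H = 36) (P : Sylow 3 H) {a b : H} (ha : a ∈ (P : Subgroup H))
    (hb : b ∈ (P : Subgroup H)) : a * b = b * a := by
  have hc := IsPGroup.isMulCommutative_of_card_eq_prime_sq (p := 3) (G := (P : Subgroup H))
    (by rw [card_sylow h36 P]; norm_num)
  have := hc.is_comm.comm (⟨a, ha⟩ : (P : Subgroup H)) ⟨b, hb⟩
  exact congrArg Subtype.val this

/-- The order of an element of a Sylow `3`-subgroup divides `9`. [folklore] -/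
theorem orderOf_dvd_nine (h36 : Nat.card H = 36) (P : Sylow 3 H) {x : H} (hx : x ∈ (P : Subgroup H)) :
    orderOf x ∣ 9 :=
  card_sylow h36 P ▸ (P : Subgroup H).orderOf_dvd_natCard hx

/-- **The Sylow `3`-subgroup of a centreless group of order `36` is normal.**  If not, there are
four Sylow `3`-subgroups, `N_H(P) = P`, and two of them meet in a subgroup `D` of order `3`
(index count); both being abelian, the centraliser `C` of `D` has order `18` (it is not all of
`H` because `Z(H) = 1`), so `P ⊴ C` (index `2`) and `C ≤ N_H(P) = P`, absurd. [folklore] -/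
theorem sylow_normal (h36 : Nat.card H = 36) (hZ : center H = ⊥) (P : Sylow 3 H) :
    (P : Subgroup H).Normal := by
  classical
  have hmod : Nat.card (Sylow 3 H) ≡ 1 [MOD 3] := card_sylow_modEq_one 3 H
  have hdvd : Nat.card (Sylow 3 H) ∣ (P : Subgroup H).index := P.card_dvd_index
  rw [index_sylow h36 P] at hdvd
  have hn : Nat.card (Sylow 3 H) = 1 ∨ Nat.card (Sylow 3 H) = 4 := by
    have hle : Nat.card (Sylow 3 H) ≤ 4 := Nat.le_of_dvd (by norm_num) hdvd
    generalize Nat.card (Sylow 3 H) = s at hmod hdvd hle ⊢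
    interval_cases s
    · exact absurd hdvd (by decide)
    · exact Or.inl rfl
    · exact absurd hmod (by decide)
    · exact absurd hdvd (by decide)
    · exact Or.inr rfl
  rcases hn with h1 | h4
  · haveI : Subsingleton (Sylow 3 H) := (Nat.card_eq_one_iff_unique.mp h1).1
    exact P.normal_of_subsingleton
  · exfalso
    -- `N_H(P) = P`
    have hNP : normalizer ((P : Subgroup H) : Set H) = P := by
      have hidx : (normalizer ((P : Subgroup H) : Set H)).index = 4 := by
        have := P.card_eq_index_normalizer
        rw [h4] at this
        exact this.symm
      have hrel := relIndex_mul_index (le_normalizer : (P : Subgroup H) ≤ normalizer (P : Set H))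
      rw [hidx, index_sylow h36 P] at hrel
      have hrel1 : (P : Subgroup H).relIndex (normalizer ((P : Subgroup H) : Set H)) = 1 := by
        omega
      exact le_antisymm (relIndex_eq_one.mp hrel1) le_normalizer
    -- a second Sylow `3`-subgroup `Q ≠ P`
    haveI : Nontrivial (Sylow 3 H) := Finite.one_lt_card_iff_nontrivial.mp (by rw [h4]; norm_num)
    obtain ⟨Q, hQP⟩ := exists_ne P
    -- `D = P ⊓ Q` has order `3`
    set D : Subgroup H := (P : Subgroup H) ⊓ (Q : Subgroup H) with hD
    have hDcard : Nat.card D = 3 := by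
      have hdvd9 : Nat.card D ∣ 9 := card_sylow h36 P ▸ card_dvd_of_le inf_le_left
      have hidx : D.index ≤ 16 := by
        have := index_inf_le (H := (P : Subgroup H)) (K := (Q : Subgroup H))
        rwa [index_sylow h36 P, index_sylow h36 Q] at this
      have hmul : D.index * Nat.card D = 36 := by rw [index_mul_card, h36]
      have hne9 : Nat.card D ≠ 9 := by
        intro h9
        apply hQP
        have hDP : D = (P : Subgroup H) :=
          eq_of_le_of_card_ge inf_le_left (by rw [h9, card_sylow h36 P])
        have hDQ : D = (Q : Subgroup H) :=
          eq_of_le_of_card_ge inf_le_right (by rw [h9, card_sylow h36 Q])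
        exact Sylow.ext (hDQ.symm.trans hDP)
      rcases eq_of_dvd_nine hdvd9 with h1 | h3 | h9
      · rw [h1] at hmul
        omega
      · exact h3
      · exact absurd h9 hne9
    -- the centraliser `C` of `D` contains `P` and `Q`
    set C : Subgroup H := centralizer (D : Set H) with hC
    have hPC : (P : Subgroup H) ≤ C := fun a ha =>
      mem_centralizer_iff.mpr fun d hd => sylow_comm h36 P hd.1 ha
    have hQC : (Q : Subgroup H) ≤ C := fun a ha =>
      mem_centralizer_iff.mpr fun d hd => sylow_comm h36 Q hd.2 ha
    -- `C ≠ ⊤` since `D` is not central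
    have hCtop : C ≠ ⊤ := by
      intro htop
      have hDZ : (D : Set H) ⊆ center H := centralizer_eq_top_iff_subset.mp htop
      rw [hZ] at hDZ
      have hDbot : D = ⊥ := le_bot_iff.mp fun x hx => hDZ hx
      rw [hDbot, card_bot] at hDcard
      exact absurd hDcard (by norm_num)
    -- `|C| = 18`
    have hCcard : Nat.card C = 18 := by
      have h9 : 9 ∣ Nat.card C := card_sylow h36 P ▸ card_dvd_of_le hPC
      have h36' : Nat.card C ∣ 36 := h36 ▸ card_subgroup_dvd_card C
      have hne36 : Nat.card C ≠ 36 := fun h => hCtop ((card_eq_iff_eq_top _).mp (h.trans h36.symm))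
      have hne9 : Nat.card C ≠ 9 := by
        intro h9c
        apply hQP
        have hCP : (P : Subgroup H) = C := eq_of_le_of_card_ge hPC (by rw [h9c, card_sylow h36 P])
        have hCQ : (Q : Subgroup H) = C := eq_of_le_of_card_ge hQC (by rw [h9c, card_sylow h36 Q])
        exact Sylow.ext (hCQ.trans hCP.symm)
      obtain ⟨m, hm⟩ := h9
      rw [hm] at h36' hne36 hne9 ⊢
      have hm4 : m ∣ 4 := Nat.dvd_of_mul_dvd_mul_left (by norm_num : 0 < 9) h36'
      have hmle : m ≤ 4 := Nat.le_of_dvd (by norm_num) hm4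
      interval_cases m
      · exact absurd hm4 (by decide)
      · exact absurd rfl hne9
      · rfl
      · exact absurd hm4 (by decide)
      · exact absurd rfl hne36
    -- `P` has index `2` in `C`, hence is normal in `C`, hence `C ≤ N_H(P) = P`: contradiction
    have hrel : (P : Subgroup H).relIndex C = 2 := by
      have h1 := relIndex_mul_index hPC
      have h2 : C.index = 2 := by
        have := C.index_mul_card
        rw [hCcard, h36] at this
        omega
      rw [h2, index_sylow h36 P] at h1
      omega
    have hnorm : ((P : Subgroup H).subgroupOf C).Normal := normal_of_index_eq_two hrel
    have hCle : C ≤ normalizer ((P : Subgroup H) : Set H) :=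
      (normal_subgroupOf_iff_le_normalizer hPC).mp hnorm
    rw [hNP] at hCle
    have := card_le_of_le hCle
    rw [hCcard, card_sylow h36 P] at this
    omega

/-- `⟨P, g⟩ = H` for the Sylow `3`-subgroup `P` and an element `g` of order `4` (orders `9` and
`4` are coprime and `9 · 4 = 36`). [folklore] -/
theorem sup_zpowers_eq_top (h36 : Nat.card H = 36) {g : H} (hg : orderOf g = 4) (P : Sylow 3 H) :
    (P : Subgroup H) ⊔ zpowers g = ⊤ := by
  set S : Subgroup H := (P : Subgroup H) ⊔ zpowers g with hS
  have h9 : 9 ∣ Nat.card S := card_sylow h36 P ▸ card_dvd_of_le le_sup_left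
  have h4 : 4 ∣ Nat.card S := by
    have := card_dvd_of_le (le_sup_right : zpowers g ≤ S)
    rwa [Nat.card_zpowers, hg] at this
  have h36' : Nat.card S ∣ 36 := h36 ▸ card_subgroup_dvd_card S
  have h36'' : 36 ∣ Nat.card S :=
    Nat.Coprime.mul_dvd_of_dvd_of_dvd (by norm_num : Nat.Coprime 9 4) h9 h4
  exact (card_eq_iff_eq_top _).mp ((Nat.dvd_antisymm h36' h36'').trans h36.symm)

omit [Finite H] in
/-- `g⁴ = 1` for an element of order `4`. [folklore] -/
theorem pow_four_eq_one {g : H} (hg : orderOf g = 4) : g ^ 4 = 1 :=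
  hg ▸ pow_orderOf_eq_one g

omit [Finite H] in
/-- `g² · g² = 1` for an element of order `4`. [folklore] -/
theorem sq_mul_sq_eq_one {g : H} (hg : orderOf g = 4) : g ^ 2 * g ^ 2 = 1 := by
  rw [← pow_add]
  exact pow_four_eq_one hg

omit [Finite H] in
/-- `g² ≠ 1` for an element of order `4`. [folklore] -/
theorem sq_ne_one {g : H} (hg : orderOf g = 4) : g ^ 2 ≠ 1 := fun h => by
  have := orderOf_dvd_of_pow_eq_one h
  rw [hg] at this
  omega

/-- `g² ∉ P` for `g` of order `4` and `P` the Sylow `3`-subgroup. [folklore] -/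
theorem sq_not_mem (h36 : Nat.card H = 36) {g : H} (hg : orderOf g = 4) (P : Sylow 3 H) :
    g ^ 2 ∉ (P : Subgroup H) := fun hmem => by
  have h9 := orderOf_dvd_nine h36 P hmem
  have h2 : orderOf (g ^ 2) = 2 := by
    rw [orderOf_pow' g (by norm_num : 2 ≠ 0), hg]
    decide
  rw [h2] at h9
  omega

/-- **Conjugation by `g²` inverts the Sylow `3`-subgroup** (`H` of order `36`, `Z(H) = 1`,
`ord g = 4`).  The elements of `P` inverted by `g²` form a `g`-stable subgroup `F ≤ P`;
`|F| = 1` would make `g²` centralise `P` and `g`, i.e. `g² ∈ Z(H) = 1`; `|F| = 3` would make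
conjugation by `g` an automorphism of `F ≅ C_3` squaring to inversion, impossible since
`-1` is not a square mod `3`; so `F = P`. [folklore] -/
theorem conj_sq_eq_inv (h36 : Nat.card H = 36) (hZ : center H = ⊥) {g : H} (hg : orderOf g = 4)
    (P : Sylow 3 H) {x : H} (hx : x ∈ (P : Subgroup H)) : g ^ 2 * x * (g ^ 2)⁻¹ = x⁻¹ := by
  have hN : (P : Subgroup H).Normal := sylow_normal h36 hZ P
  set F : Subgroup H := invertedBy (P : Subgroup H) (fun a ha b hb => sylow_comm h36 P ha hb) (g ^ 2)
    with hF
  have hFle : F ≤ (P : Subgroup H) := invertedBy_le _ _ _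
  have hFdvd : Nat.card F ∣ 9 := card_sylow h36 P ▸ card_dvd_of_le hFle
  -- for every `x ∈ P`, `x (g² x g⁻²)⁻¹ ∈ F`
  have key : ∀ y ∈ (P : Subgroup H), y * (g ^ 2 * y * (g ^ 2)⁻¹)⁻¹ ∈ F := fun y hy =>
    ⟨(P : Subgroup H).mul_mem hy ((P : Subgroup H).inv_mem (hN.conj_mem y hy _)),
      conj_mul_conj_inv_eq_inv (sq_mul_sq_eq_one hg)⟩
  rcases eq_of_dvd_nine hFdvd with h1 | h3 | h9
  · -- `F = ⊥`: `g²` centralises `P`, hence is central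
    exfalso
    have hFbot : F = ⊥ := eq_bot_of_card_eq F h1
    have hfix : ∀ y ∈ (P : Subgroup H), g ^ 2 * y = y * g ^ 2 := by
      intro y hy
      have hu := key y hy
      rw [hFbot, mem_bot, mul_inv_eq_one] at hu
      exact (mul_inv_eq_iff_eq_mul.mp hu.symm)
    apply sq_ne_one hg
    have hmem : g ^ 2 ∈ center H := by
      have htop : centralizer ({g ^ 2} : Set H) = ⊤ := by
        rw [eq_top_iff, ← sup_zpowers_eq_top h36 hg P, sup_le_iff]
        constructor
        · intro y hy
          rw [mem_centralizer_iff]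
          rintro _ rfl
          exact hfix y hy
        · rw [zpowers_le, mem_centralizer_iff]
          rintro _ rfl
          rw [← pow_succ, ← pow_succ']
      have := centralizer_eq_top_iff_subset.mp htop
      exact this (Set.mem_singleton _)
    rwa [hZ, mem_bot] at hmem
  · -- `|F| = 3`: conjugation by `g` on `F ≅ C_3` would square to inversion
    exfalso
    obtain ⟨y, hyF, hy1⟩ : ∃ y ∈ F, y ≠ 1 := by
      by_contra h
      push Not at h
      have : F = ⊥ := (Subgroup.eq_bot_iff_forall _).mpr h
      rw [this, card_bot] at h3
      exact absurd h3 (by norm_num)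
    have hy3 : orderOf y = 3 := by
      have hdvd : orderOf y ∣ 3 := h3 ▸ F.orderOf_dvd_natCard hyF
      rcases (Nat.dvd_prime Nat.prime_three).mp hdvd with h | h
      · exact absurd (orderOf_eq_one_iff.mp h) hy1
      · exact h
    have hσy : g * y * g⁻¹ ∈ F := by
      refine ⟨hN.conj_mem y hyF.1 g, ?_⟩
      have hy2 := hyF.2
      calc g ^ 2 * (g * y * g⁻¹) * (g ^ 2)⁻¹ = g * (g ^ 2 * y * (g ^ 2)⁻¹) * g⁻¹ := by group
        _ = g * y⁻¹ * g⁻¹ := by rw [hy2]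
        _ = (g * y * g⁻¹)⁻¹ := by group
    have hFy : zpowers y = F :=
      eq_of_le_of_card_ge (zpowers_le.mpr hyF) (by rw [Nat.card_zpowers, hy3, h3])
    rw [← hFy] at hσy
    have hpow : g * y * g⁻¹ ∈ Submonoid.powers y :=
      (isOfFinOrder_of_finite y).mem_powers_iff_mem_zpowers.mpr hσy
    exact not_three_dvd_orderOf hpow hyF.2 (dvd_of_eq hy3.symm)
  · -- `F = P`
    have hFP : F = (P : Subgroup H) := eq_of_le_of_card_ge hFle (by rw [h9, card_sylow h36 P])
    have hxF : x ∈ F := by rw [hFP]; exact hx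
    exact hxF.2

/-- An element of `P` conjugated by `g` into its own cyclic subgroup is trivial. [folklore] -/
theorem eq_one_of_conj_mem_zpowers (h36 : Nat.card H = 36) (hZ : center H = ⊥) {g : H}
    (hg : orderOf g = 4) (P : Sylow 3 H) {x : H} (hx : x ∈ (P : Subgroup H))
    (h : g * x * g⁻¹ ∈ zpowers x) : x = 1 := by
  have h3 : ¬ 3 ∣ orderOf x :=
    not_three_dvd_orderOf ((isOfFinOrder_of_finite x).mem_powers_iff_mem_zpowers.mpr h)
      (conj_sq_eq_inv h36 hZ hg P hx)
  rcases eq_of_dvd_nine (orderOf_dvd_nine h36 P hx) with h1 | h3' | h9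
  · exact orderOf_eq_one_iff.mp h1
  · exact absurd (dvd_of_eq h3'.symm) h3
  · exact absurd ⟨3, by rw [h9]⟩ h3

/-- **`P` has exponent `3`** (it is elementary abelian of order `9`). [folklore] -/
theorem pow_three_eq_one (h36 : Nat.card H = 36) (hZ : center H = ⊥) {g : H} (hg : orderOf g = 4)
    (P : Sylow 3 H) {x : H} (hx : x ∈ (P : Subgroup H)) : x ^ 3 = 1 := by
  have hN : (P : Subgroup H).Normal := sylow_normal h36 hZ P
  rcases eq_of_dvd_nine (orderOf_dvd_nine h36 P hx) with h1 | h3 | h9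
  · rw [orderOf_eq_one_iff.mp h1, one_pow]
  · rw [← h3]
    exact pow_orderOf_eq_one x
  · exfalso
    have hxP : zpowers x = (P : Subgroup H) :=
      eq_of_le_of_card_ge (zpowers_le.mpr hx) (by rw [Nat.card_zpowers, h9, card_sylow h36 P])
    have hmem : g * x * g⁻¹ ∈ zpowers x := by
      rw [hxP]
      exact hN.conj_mem x hx g
    have := eq_one_of_conj_mem_zpowers h36 hZ hg P hx hmem
    rw [this, orderOf_one] at h9
    exact absurd h9 (by norm_num)

/-- No non-trivial element of `P` commutes with `g`. [folklore] -/
theorem eq_one_of_commute (h36 : Nat.card H = 36) (hZ : center H = ⊥) {g : H} (hg : orderOf g = 4)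
    (P : Sylow 3 H) {x : H} (hx : x ∈ (P : Subgroup H)) (h : g * x = x * g) : x = 1 :=
  eq_one_of_conj_mem_zpowers h36 hZ hg P hx
    (by rw [mul_inv_eq_iff_eq_mul.mpr h]; exact mem_zpowers x)

/-- No non-trivial element of `P` commutes with `g²`. [folklore] -/
theorem eq_one_of_commute_sq (h36 : Nat.card H = 36) (hZ : center H = ⊥) {g : H}
    (hg : orderOf g = 4) (P : Sylow 3 H) {x : H} (hx : x ∈ (P : Subgroup H))
    (h : g ^ 2 * x = x * g ^ 2) : x = 1 := by
  have h1 : g ^ 2 * x * (g ^ 2)⁻¹ = x := mul_inv_eq_iff_eq_mul.mpr h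
  have h2 := conj_sq_eq_inv h36 hZ hg P hx
  have hx2 : x ^ 2 = 1 := by
    rw [sq, mul_eq_one_iff_eq_inv]
    exact h1.symm.trans h2
  have hd : orderOf x ∣ Nat.gcd 9 2 :=
    Nat.dvd_gcd (orderOf_dvd_nine h36 P hx) (orderOf_dvd_of_pow_eq_one hx2)
  exact orderOf_eq_one_iff.mp (Nat.dvd_one.mp hd)

/-- Every element of `H` is `x gⁱ` with `x ∈ P` and `0 ≤ i < 4`. [folklore] -/
theorem exists_eq_mul_pow (h36 : Nat.card H = 36) (hZ : center H = ⊥) {g : H} (hg : orderOf g = 4)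
    (P : Sylow 3 H) (h : H) : ∃ x ∈ (P : Subgroup H), ∃ i : ℕ, i < 4 ∧ h = x * g ^ i := by
  haveI hN : (P : Subgroup H).Normal := sylow_normal h36 hZ P
  have hmem : h ∈ (((P : Subgroup H) ⊔ zpowers g : Subgroup H) : Set H) := by
    rw [sup_zpowers_eq_top h36 hg P]
    exact mem_top h
  rw [normal_mul] at hmem
  obtain ⟨x, hx, z, hz, rfl⟩ := Set.mem_mul.mp hmem
  obtain ⟨k, rfl⟩ := mem_zpowers_iff.mp hz
  refine ⟨x, hx, (k % 4).toNat, ?_, ?_⟩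
  · have h1 := Int.emod_lt_of_pos k (by norm_num : (0 : ℤ) < 4)
    have h2 := Int.emod_nonneg k (by norm_num : (4 : ℤ) ≠ 0)
    omega
  · congr 1
    rw [← zpow_natCast, Int.toNat_of_nonneg (Int.emod_nonneg k (by norm_num)),
      show (4 : ℤ) = (orderOf g : ℤ) by rw [hg]; rfl, zpow_mod_orderOf]

/-- An element whose square is `w g²` with `w ∈ P` has order `4`. [folklore] -/
theorem orderOf_eq_four_of_sq (h36 : Nat.card H = 36) (hZ : center H = ⊥) {g : H}
    (hg : orderOf g = 4) (P : Sylow 3 H) {h w : H} (hw : w ∈ (P : Subgroup H))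
    (h2 : h ^ 2 = w * g ^ 2) : orderOf h = 4 := by
  have hsq : (w * g ^ 2) * (w * g ^ 2) = 1 := by
    calc w * g ^ 2 * (w * g ^ 2) = w * (g ^ 2 * w * (g ^ 2)⁻¹) * (g ^ 2 * g ^ 2) := by group
      _ = 1 := by rw [conj_sq_eq_inv h36 hZ hg P hw, sq_mul_sq_eq_one hg, mul_inv_cancel, one_mul]
  have h4 : h ^ 2 ^ (1 + 1) = 1 := by
    rw [show 2 ^ (1 + 1) = 2 * 2 from rfl, pow_mul, h2, sq, hsq]
  have h2ne : ¬ h ^ 2 ^ 1 = 1 := by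
    rw [pow_one, h2]
    intro h1
    apply sq_not_mem h36 hg P
    rw [eq_inv_of_mul_eq_one_right h1]
    exact (P : Subgroup H).inv_mem hw
  have := orderOf_eq_prime_pow h2ne h4
  simpa using this

/-- **Elements outside `P` have order `2` or `4`.** [folklore] -/
theorem orderOf_eq_two_or_four (h36 : Nat.card H = 36) (hZ : center H = ⊥) {g : H}
    (hg : orderOf g = 4) (P : Sylow 3 H) {h : H} (hh : h ∉ (P : Subgroup H)) :
    orderOf h = 2 ∨ orderOf h = 4 := by
  have hN : (P : Subgroup H).Normal := sylow_normal h36 hZ P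
  obtain ⟨x, hx, i, hi, rfl⟩ := exists_eq_mul_pow h36 hZ hg P h
  interval_cases i
  · exact absurd (by simpa using hx) hh
  · right
    refine orderOf_eq_four_of_sq h36 hZ hg P ((P : Subgroup H).mul_mem hx (hN.conj_mem x hx g)) ?_
    rw [pow_one, sq]
    group
  · left
    refine orderOf_eq_prime ?_ ?_
    · calc (x * g ^ 2) ^ 2 = x * (g ^ 2 * x * (g ^ 2)⁻¹) * (g ^ 2 * g ^ 2) := by rw [sq]; group
        _ = 1 := by rw [conj_sq_eq_inv h36 hZ hg P hx, sq_mul_sq_eq_one hg, mul_inv_cancel, one_mul]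
    · intro h1
      apply hh
      rw [h1]
      exact (P : Subgroup H).one_mem
  · right
    refine orderOf_eq_four_of_sq h36 hZ hg P
      ((P : Subgroup H).mul_mem hx (hN.conj_mem x hx (g ^ 3))) ?_
    calc (x * g ^ 3) ^ 2 = x * (g ^ 3 * x * (g ^ 3)⁻¹) * (g ^ 4 * g ^ 2) := by rw [sq]; group
      _ = x * (g ^ 3 * x * (g ^ 3)⁻¹) * g ^ 2 := by rw [pow_four_eq_one hg, one_mul]

/-- **No non-trivial element of `P` is centralised by an element outside `P`.** [folklore] -/
theorem eq_one_of_commute_of_not_mem (h36 : Nat.card H = 36) (hZ : center H = ⊥) {g : H}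
    (hg : orderOf g = 4) (P : Sylow 3 H) {h x : H} (hh : h ∉ (P : Subgroup H))
    (hx : x ∈ (P : Subgroup H)) (hc : h * x = x * h) : x = 1 := by
  obtain ⟨y, hy, i, hi, rfl⟩ := exists_eq_mul_pow h36 hZ hg P h
  have key : g ^ i * x * (g ^ i)⁻¹ = x := by
    have hcomm : y * x = x * y := sylow_comm h36 P hy hx
    calc g ^ i * x * (g ^ i)⁻¹ = y⁻¹ * ((y * g ^ i) * x) * (g ^ i)⁻¹ := by group
      _ = y⁻¹ * (x * (y * g ^ i)) * (g ^ i)⁻¹ := by rw [hc]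
      _ = y⁻¹ * (x * y) := by group
      _ = y⁻¹ * (y * x) := by rw [hcomm]
      _ = x := by group
  interval_cases i
  · exact absurd (by simpa using hy) hh
  · exact eq_one_of_commute h36 hZ hg P hx (by simpa using (mul_inv_eq_iff_eq_mul.mp key))
  · exact eq_one_of_commute_sq h36 hZ hg P hx (mul_inv_eq_iff_eq_mul.mp key)
  · apply eq_one_of_commute h36 hZ hg P hx
    have hg3 : g ^ 3 = g⁻¹ := by
      rw [eq_inv_iff_mul_eq_one, ← pow_succ, pow_four_eq_one hg]
    rw [hg3, inv_inv] at key
    have := congrArg (g * ·) key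
    simp only [← mul_assoc, mul_inv_cancel, one_mul] at this
    exact this.symm

/-- **Structure of centreless groups of order `36` with an element of order `4`** (= the route
item `Order36Frobenius` of `Summits/Langlands/Langlands/Theses/HessianFirstBlood`): there is a
normal subgroup `N` of order `9` and exponent `3`, every element outside `N` has order `2` or
`4`, and no non-trivial element of `N` commutes with an element outside `N` (`H = N ⋊ C_4` is
the Frobenius group `3² : 4`).  Elementary Sylow theory. [folklore] -/
theorem order36Frobenius (H : Type*) [Group H] [Finite H] (h36 : Nat.card H = 36)
    (hZ : Subgroup.center H = ⊥) (h4 : ∃ g : H, orderOf g = 4) :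
    ∃ N : Subgroup H, N.Normal ∧ Nat.card N = 9 ∧ (∀ x ∈ N, x ^ 3 = 1) ∧
      (∀ g : H, g ∉ N → orderOf g = 2 ∨ orderOf g = 4) ∧
        ∀ g : H, g ∉ N → ∀ x ∈ N, g * x = x * g → x = 1 := by
  obtain ⟨g, hg⟩ := h4
  obtain ⟨P⟩ : Nonempty (Sylow 3 H) := inferInstance
  exact ⟨P, sylow_normal h36 hZ P, card_sylow h36 P, fun x hx => pow_three_eq_one h36 hZ hg P hx,
    fun h hh => orderOf_eq_two_or_four h36 hZ hg P hh,
    fun h hh x hx hc => eq_one_of_commute_of_not_mem h36 hZ hg P hh hx hc⟩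

end Order36

/-! ### Part 2: the model `3² : 4 = (ℤ/3)² ⋊ ℤ/4` (SmallGroup(36,9)) -/

section PowHom

variable {M : Type*} [Monoid M]

/-- The monoid homomorphism `Multiplicative (ZMod n) →* M`, `i ↦ x ^ i`, determined by an
element `x` with `x ^ n = 1`. [folklore] -/
def powHom {n : ℕ} [NeZero n] (x : M) (hx : x ^ n = 1) : Multiplicative (ZMod n) →* M where
  toFun c := x ^ (Multiplicative.toAdd c).val
  map_one' := by rw [toAdd_one, ZMod.val_zero, pow_zero]
  map_mul' a b := by
    rw [toAdd_mul, ZMod.val_add, ← pow_eq_pow_mod _ hx, pow_add]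

/-- Unfolding lemma for `powHom`. [folklore] -/
@[simp] theorem powHom_apply {n : ℕ} [NeZero n] (x : M) (hx : x ^ n = 1)
    (c : Multiplicative (ZMod n)) : powHom x hx c = x ^ (Multiplicative.toAdd c).val :=
  rfl

/-- `powHom` on `ofAdd i`. [folklore] -/
theorem powHom_ofAdd {n : ℕ} [NeZero n] (x : M) (hx : x ^ n = 1) (i : ZMod n) :
    powHom x hx (Multiplicative.ofAdd i) = x ^ i.val :=
  rfl

end PowHom

section Model

/-- `V = 𝔽₃²`, written multiplicatively. [folklore] -/
abbrev V : Type := Multiplicative (ZMod 3 × ZMod 3)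

/-- `C₄ = ℤ/4`, written multiplicatively. [folklore] -/
abbrev C4 : Type := Multiplicative (ZMod 4)

/-- The quarter-turn `(a, b) ↦ (-b, a)` of `𝔽₃²`: an additive automorphism of order `4`
squaring to `-1`, i.e. (a generator of) a cyclic subgroup of order `4` of `SL₂(𝔽₃)`;
it acts without non-zero fixed points. [folklore] -/
def rotAdd : ZMod 3 × ZMod 3 ≃+ ZMod 3 × ZMod 3 where
  toFun p := (-p.2, p.1)
  invFun p := (p.2, -p.1)
  left_inv p := by simp
  right_inv p := by simp
  map_add' p q := Prod.ext (neg_add p.2 q.2) rfl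

/-- The quarter-turn as an automorphism of the multiplicative group `V`. [folklore] -/
def rot : MulAut V := AddEquiv.toMultiplicative rotAdd

/-- `rot (a, b) = (-b, a)`. [folklore] -/
@[simp] theorem rot_ofAdd (p : ZMod 3 × ZMod 3) :
    rot (Multiplicative.ofAdd p) = Multiplicative.ofAdd (-p.2, p.1) :=
  rfl

/-- `rot² = -1` on `V`. [folklore] -/
theorem rot_rot_ofAdd (p : ZMod 3 × ZMod 3) :
    rot (rot (Multiplicative.ofAdd p)) = Multiplicative.ofAdd (-p) := by
  rw [rot_ofAdd, rot_ofAdd]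
  rfl

/-- `rot⁴ = 1`. [folklore] -/
theorem rot_pow_four : rot ^ 4 = 1 := by
  refine MulEquiv.ext fun v => ?_
  obtain ⟨p, rfl⟩ : ∃ p, Multiplicative.ofAdd p = v := ⟨Multiplicative.toAdd v, rfl⟩
  simp only [pow_succ, pow_zero, one_mul, MulAut.mul_apply, MulAut.one_apply, rot_rot_ofAdd,
    neg_neg]

/-- `rot` has no non-trivial fixed point. [folklore] -/
theorem eq_one_of_rot_apply_eq {v : V} (h : rot v = v) : v = 1 := by
  obtain ⟨p, rfl⟩ : ∃ p, Multiplicative.ofAdd p = v := ⟨Multiplicative.toAdd v, rfl⟩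
  rw [rot_ofAdd] at h
  have hp := Multiplicative.ofAdd.injective h
  have key : ∀ q : ZMod 3 × ZMod 3, (-q.2, q.1) = q → q = 0 := by decide
  rw [key p hp]
  rfl

/-- The action `ℤ/4 → Aut(𝔽₃²)`, generator `↦ rot`. [folklore] -/
def rotHom : C4 →* MulAut V :=
  powHom rot rot_pow_four

/-- Unfolding lemma for `rotHom`. [folklore] -/
theorem rotHom_apply (c : C4) : rotHom c = rot ^ (Multiplicative.toAdd c).val :=
  rfl

/-- Only the identity of `ℤ/4` fixes the first basis vector under `rotHom`. [folklore] -/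
theorem eq_one_of_rotHom_apply_eq {c : C4}
    (h : rotHom c (Multiplicative.ofAdd (1, 0)) = Multiplicative.ofAdd (1, 0)) : c = 1 := by
  obtain ⟨i, rfl⟩ : ∃ i, Multiplicative.ofAdd i = c := ⟨Multiplicative.toAdd c, rfl⟩
  rw [rotHom_apply] at h
  have key : ∀ j : ZMod 4, j.val = 0 ∨ j.val = 1 ∨ j.val = 2 ∨ j.val = 3 := by decide
  change Multiplicative.ofAdd i = Multiplicative.ofAdd 0
  rcases key i with h0 | h1 | h2 | h3
  · rw [(ZMod.val_eq_zero i).mp h0]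
  · exfalso
    rw [show (Multiplicative.toAdd (Multiplicative.ofAdd i)).val = 1 from h1, pow_one,
      rot_ofAdd] at h
    exact absurd (Multiplicative.ofAdd.injective h) (by decide)
  · exfalso
    rw [show (Multiplicative.toAdd (Multiplicative.ofAdd i)).val = 2 from h2, sq,
      MulAut.mul_apply, rot_rot_ofAdd] at h
    exact absurd (Multiplicative.ofAdd.injective h) (by decide)
  · exfalso
    rw [show (Multiplicative.toAdd (Multiplicative.ofAdd i)).val = 3 from h3, pow_succ, sq,
      MulAut.mul_apply, MulAut.mul_apply, rot_ofAdd, rot_rot_ofAdd] at h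
    exact absurd (Multiplicative.ofAdd.injective h) (by decide)

/-- **The model**: the Frobenius group `3² : 4 = 𝔽₃² ⋊ ℤ/4` (ℤ/4 acting through the quarter-turn
`rot ∈ SL₂(𝔽₃)`), i.e. `SmallGroup(36, 9)`; this is `V ⋊ B` of Lapid 1998, §5 for `q = 3` and
`B ≅ ℤ/4`, the projective image of Blichfeldt's primitive group of order `108`.
[cite: Lapid1998, §5] -/
abbrev Model : Type := V ⋊[rotHom] C4

/-- The model is a finite group (`3² : 4` has `36` elements). [folklore] -/
instance : Finite Model := Finite.of_equiv (V × C4) SemidirectProduct.equivProd.symm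

/-- `|3² : 4| = 36`. [folklore] -/
theorem card_model : Nat.card Model = 36 := by
  rw [SemidirectProduct.card, Nat.card_congr Multiplicative.toAdd, Nat.card_congr Multiplicative.toAdd,
    Nat.card_prod, Nat.card_zmod, Nat.card_zmod]

/-- The generator of `ℤ/4` has order `4` in the model. [folklore] -/
theorem orderOf_inr_one :
    orderOf (SemidirectProduct.inr (Multiplicative.ofAdd (1 : ZMod 4)) : Model) = 4 := by
  rw [orderOf_injective SemidirectProduct.inr SemidirectProduct.inr_injective,
    orderOf_ofAdd_eq_addOrderOf, ZMod.addOrderOf_one]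

/-- **The model is centreless.** An element commuting with the generator of `ℤ/4` has
`V`-component fixed by `rot`, hence trivial; an element of `ℤ/4` commuting with `(1,0) ∈ V`
fixes it, hence is trivial. [folklore] -/
theorem center_model : center Model = ⊥ := by
  rw [eq_bot_iff]
  intro z hz
  rw [mem_bot]
  have hz' := mem_center_iff.mp hz
  have hl : z.left = 1 := by
    have h := congrArg SemidirectProduct.left
      (hz' (SemidirectProduct.inr (Multiplicative.ofAdd (1 : ZMod 4))))
    simp only [SemidirectProduct.mul_left, SemidirectProduct.left_inr,
      SemidirectProduct.right_inr, one_mul, map_one, mul_one] at h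
    rw [rotHom_apply, show (Multiplicative.toAdd (Multiplicative.ofAdd (1 : ZMod 4))).val = 1
      from rfl, pow_one] at h
    exact eq_one_of_rot_apply_eq h
  have hr : z.right = 1 := by
    have h := congrArg SemidirectProduct.left
      (hz' (SemidirectProduct.inl (Multiplicative.ofAdd ((1 : ZMod 3), (0 : ZMod 3)))))
    simp only [SemidirectProduct.mul_left, SemidirectProduct.left_inl,
      SemidirectProduct.right_inl, map_one, hl, mul_one, one_mul] at h
    exact eq_one_of_rotHom_apply_eq h.symm
  exact SemidirectProduct.ext hl hr

/-- The model has order `36`, trivial centre and an element of order `4`. [folklore] -/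
theorem model_invariants :
    Nat.card Model = 36 ∧ center Model = ⊥ ∧ ∃ g : Model, orderOf g = 4 :=
  ⟨card_model, center_model, ⟨_, orderOf_inr_one⟩⟩

end Model

/-! ### Part 3: recognition `H ≃* 3² : 4` -/

section PairHom

variable {H : Type*} [Group H]

/-- The homomorphism `V = (ℤ/3)² →* H`, `(a, b) ↦ xᵃ yᵇ`, determined by two commuting elements
of exponent `3`. [folklore] -/
def pairHom (x y : H) (hx : x ^ 3 = 1) (hy : y ^ 3 = 1) (hxy : Commute x y) : V →* H :=
  (MonoidHom.noncommCoprod (powHom x hx) (powHom y hy) fun _ _ => hxy.pow_pow _ _).comp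
    (MulEquiv.toMonoidHom (MulEquiv.prodMultiplicative (ZMod 3) (ZMod 3)))

/-- `pairHom x y (a, b) = x ^ a * y ^ b`. [folklore] -/
theorem pairHom_ofAdd {x y : H} (hx : x ^ 3 = 1) (hy : y ^ 3 = 1) (hxy : Commute x y)
    (a b : ZMod 3) :
    pairHom x y hx hy hxy (Multiplicative.ofAdd (a, b)) = x ^ a.val * y ^ b.val :=
  rfl

/-- If `g x g⁻¹ = y` and `g y g⁻¹ = x⁻¹` then conjugation by `g` acts on `pairHom x y` through
the quarter-turn `rot`. [folklore] -/
theorem conj_pairHom {g x y : H} (hx : x ^ 3 = 1) (hy : y ^ 3 = 1) (hxy : Commute x y)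
    (hgx : g * x * g⁻¹ = y) (hgy : g * y * g⁻¹ = x⁻¹) (v : V) :
    g * pairHom x y hx hy hxy v * g⁻¹ = pairHom x y hx hy hxy (rot v) := by
  obtain ⟨⟨a, b⟩, rfl⟩ : ∃ p, Multiplicative.ofAdd p = v := ⟨Multiplicative.toAdd v, rfl⟩
  have hrot : rot (Multiplicative.ofAdd (a, b)) =
      (Multiplicative.ofAdd (b, (0 : ZMod 3)))⁻¹ * Multiplicative.ofAdd ((0 : ZMod 3), a) := by
    rw [rot_ofAdd, ← ofAdd_neg, ← ofAdd_add, Prod.neg_mk, Prod.mk_add_mk, neg_zero, zero_add,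
      add_zero]
  rw [hrot, map_mul, map_inv, pairHom_ofAdd, pairHom_ofAdd, pairHom_ofAdd, ZMod.val_zero,
    pow_zero, pow_zero, mul_one, one_mul]
  rw [show g * (x ^ a.val * y ^ b.val) * g⁻¹ = (g * x * g⁻¹) ^ a.val * (g * y * g⁻¹) ^ b.val by
    rw [conj_pow, conj_pow]; group, hgx, hgy, inv_pow]
  exact ((hxy.symm.pow_pow _ _).inv_right).eq

/-- Iterating `conj_pairHom`: conjugation by `gⁿ` acts through `rotⁿ`. [folklore] -/
theorem conj_pow_pairHom {g x y : H} (hx : x ^ 3 = 1) (hy : y ^ 3 = 1) (hxy : Commute x y)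
    (hgx : g * x * g⁻¹ = y) (hgy : g * y * g⁻¹ = x⁻¹) (n : ℕ) (v : V) :
    g ^ n * pairHom x y hx hy hxy v * (g ^ n)⁻¹ = pairHom x y hx hy hxy ((rot ^ n) v) := by
  induction n generalizing v with
  | zero => simp
  | succ n ih =>
    rw [pow_succ rot n, pow_succ g n, MulAut.mul_apply, ← ih (rot v),
      ← conj_pairHom hx hy hxy hgx hgy v]
    group

/-- `pairHom x y` is injective when `ord x = 3` and `y ∉ ⟨x⟩`. [folklore] -/
theorem pairHom_eq_one {x y : H} (hx : x ^ 3 = 1) (hy : y ^ 3 = 1) (hxy : Commute x y)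
    (hx3 : orderOf x = 3) (hind : y ∉ zpowers x) {v : V} (h : pairHom x y hx hy hxy v = 1) :
    v = 1 := by
  obtain ⟨⟨a, b⟩, rfl⟩ : ∃ p, Multiplicative.ofAdd p = v := ⟨Multiplicative.toAdd v, rfl⟩
  rw [pairHom_ofAdd] at h
  by_cases hb : b = 0
  · subst hb
    rw [ZMod.val_zero, pow_zero, mul_one] at h
    have h3 : 3 ∣ a.val := by
      have := orderOf_dvd_of_pow_eq_one h
      rwa [hx3] at this
    have ha : a.val = 0 := by
      have := ZMod.val_lt a
      omega
    rw [(ZMod.val_eq_zero a).mp ha]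
    rfl
  · exfalso
    apply hind
    have hyb : y ^ b.val = (x ^ a.val)⁻¹ := eq_inv_of_mul_eq_one_right h
    have hyb' : y ^ b.val ∈ zpowers x := by
      rw [hyb]
      exact inv_mem (pow_mem (mem_zpowers x) _)
    have hbval : b.val = 1 ∨ b.val = 2 := by
      have := ZMod.val_lt b
      have : b.val ≠ 0 := fun h0 => hb ((ZMod.val_eq_zero b).mp h0)
      omega
    rcases hbval with h1 | h2
    · rwa [h1, pow_one] at hyb'
    · rw [h2] at hyb'
      have : y = (y ^ 2)⁻¹ := by
        rw [eq_inv_iff_mul_eq_one, ← pow_succ', hy]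
      rw [this]
      exact inv_mem hyb'

end PairHom

section Recognition

variable {H : Type*} [Group H] [Finite H]

/-- **Recognition theorem**: a group of order `36` with trivial centre and an element of order `4`
is isomorphic to the model `3² : 4`.  With `P = 3²` the (normal) Sylow `3`-subgroup, `g` of
order `4`, `x₀ ∈ P ∖ 1` and `y₀ = g x₀ g⁻¹` (so `g y₀ g⁻¹ = x₀⁻¹`), the map
`((a, b), i) ↦ x₀ᵃ y₀ᵇ gⁱ` is an injective homomorphism `3² : 4 → H` between groups of the
same order. [folklore] -/
theorem nonempty_mulEquiv_model (h36 : Nat.card H = 36) (hZ : center H = ⊥)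
    (h4 : ∃ g : H, orderOf g = 4) : Nonempty (H ≃* Model) := by
  obtain ⟨g, hg⟩ := h4
  obtain ⟨P⟩ : Nonempty (Sylow 3 H) := inferInstance
  have hN : (P : Subgroup H).Normal := sylow_normal h36 hZ P
  -- a non-trivial `x₀ ∈ P` and `y₀ = g x₀ g⁻¹`
  obtain ⟨x₀, hx₀, hx₀1⟩ : ∃ x ∈ (P : Subgroup H), x ≠ 1 := by
    by_contra h
    push Not at h
    have : (P : Subgroup H) = ⊥ := (Subgroup.eq_bot_iff_forall _).mpr h
    have h9 := card_sylow h36 P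
    rw [this, card_bot] at h9
    exact absurd h9 (by norm_num)
  set y₀ : H := g * x₀ * g⁻¹ with hy₀def
  have hy₀ : y₀ ∈ (P : Subgroup H) := hN.conj_mem x₀ hx₀ g
  have hx3 : x₀ ^ 3 = 1 := pow_three_eq_one h36 hZ hg P hx₀
  have hy3 : y₀ ^ 3 = 1 := pow_three_eq_one h36 hZ hg P hy₀
  have hxy : Commute x₀ y₀ := sylow_comm h36 P hx₀ hy₀
  have hgy : g * y₀ * g⁻¹ = x₀⁻¹ := by
    rw [hy₀def, ← conj_sq_eq_inv h36 hZ hg P hx₀, sq]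
    group
  have hox : orderOf x₀ = 3 := orderOf_eq_prime hx3 hx₀1
  have hind : y₀ ∉ zpowers x₀ := fun h => hx₀1 (eq_one_of_conj_mem_zpowers h36 hZ hg P hx₀ h)
  -- the homomorphism `3² : 4 → H`
  set fn : V →* H := pairHom x₀ y₀ hx3 hy3 hxy with hfn
  set fg : C4 →* H := powHom g (pow_four_eq_one hg) with hfg
  have hcompat : ∀ c, fn.comp (rotHom c).toMonoidHom = (MulAut.conj (fg c)).toMonoidHom.comp fn := by
    intro c
    ext v
    simp only [hfg, powHom_apply, rotHom_apply, hfn]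
    exact (conj_pow_pairHom hx3 hy3 hxy rfl hgy _ v).symm
  set f : Model →* H := SemidirectProduct.lift fn fg hcompat with hf
  have hfnP : ∀ v, fn v ∈ (P : Subgroup H) := by
    intro v
    obtain ⟨⟨a, b⟩, rfl⟩ : ∃ p, Multiplicative.ofAdd p = v := ⟨Multiplicative.toAdd v, rfl⟩
    rw [hfn, pairHom_ofAdd]
    exact (P : Subgroup H).mul_mem ((P : Subgroup H).pow_mem hx₀ _) ((P : Subgroup H).pow_mem hy₀ _)
  have hinj : Function.Injective f := by
    rw [injective_iff_map_eq_one]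
    intro z hz
    rw [← SemidirectProduct.inl_left_mul_inr_right z, map_mul, hf, SemidirectProduct.lift_inl,
      SemidirectProduct.lift_inr] at hz
    have hright : z.right = 1 := by
      have hmem : g ^ (Multiplicative.toAdd z.right).val ∈ (P : Subgroup H) := by
        have h1 : fg z.right = (fn z.left)⁻¹ := eq_inv_of_mul_eq_one_right hz
        rw [hfg, powHom_apply] at h1
        rw [h1]
        exact (P : Subgroup H).inv_mem (hfnP _)
      have hlt : (Multiplicative.toAdd z.right).val < 4 := ZMod.val_lt _
      have hi : (Multiplicative.toAdd z.right).val = 0 := by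
        generalize (Multiplicative.toAdd z.right).val = i at hmem hlt
        interval_cases i
        · rfl
        · exfalso
          rw [pow_one] at hmem
          have := orderOf_dvd_nine h36 P hmem
          rw [hg] at this
          omega
        · exact absurd hmem (sq_not_mem h36 hg P)
        · exfalso
          have h3 := (P : Subgroup H).pow_mem hmem 3
          rw [← pow_mul, show 3 * 3 = 4 * 2 + 1 from rfl, pow_succ, pow_mul, pow_four_eq_one hg,
            one_pow, one_mul] at h3
          have := orderOf_dvd_nine h36 P h3
          rw [hg] at this
          omega
      have h0 : Multiplicative.toAdd z.right = 0 := (ZMod.val_eq_zero _).mp hi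
      change Multiplicative.ofAdd (Multiplicative.toAdd z.right) = Multiplicative.ofAdd 0
      rw [h0]
    have hleft : z.left = 1 := by
      rw [hright, map_one, mul_one] at hz
      exact pairHom_eq_one hx3 hy3 hxy hox hind hz
    exact SemidirectProduct.ext hleft hright
  have hbij : Function.Bijective f := hinj.bijective_of_nat_card_le (by rw [h36, card_model])
  exact ⟨(MulEquiv.ofBijective f hbij).symm⟩

omit [Finite H] in
/-- The three invariants "order `36`, trivial centre, an element of order `4`" are invariant under
group isomorphism. [folklore] -/
theorem invariants_of_mulEquiv {K : Type*} [Group K] (e : H ≃* K)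
    (h : Nat.card H = 36 ∧ center H = ⊥ ∧ ∃ g : H, orderOf g = 4) :
    Nat.card K = 36 ∧ center K = ⊥ ∧ ∃ g : K, orderOf g = 4 := by
  obtain ⟨h36, hZ, g, hg⟩ := h
  refine ⟨(Nat.card_congr e.toEquiv).symm.trans h36, ?_, ⟨e g, (e.orderOf_eq g).trans hg⟩⟩
  rw [eq_bot_iff]
  intro z hz
  rw [mem_bot]
  have hz' : e.symm z ∈ center H := by
    rw [mem_center_iff]
    intro h
    apply e.injective
    rw [map_mul, map_mul, e.apply_symm_apply]
    exact mem_center_iff.mp hz (e h)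
  rw [hZ, mem_bot] at hz'
  simpa using congrArg e hz'

omit [Finite H] in
/-- **Characterisation of `3² : 4` by three invariants**: a group has order `36`, trivial centre
and an element of order `4` iff it is isomorphic to `𝔽₃² ⋊ ℤ/4` (among the `14` groups of order
`36` only `3² : 4` and `S₃ × S₃` are centreless, and `S₃ × S₃` has exponent `6`). [folklore] -/
theorem invariants_iff_nonempty_mulEquiv_model :
    (Nat.card H = 36 ∧ center H = ⊥ ∧ ∃ g : H, orderOf g = 4) ↔ Nonempty (H ≃* Model) := by
  constructor
  · rintro ⟨h36, hZ, h4⟩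
    haveI : Finite H := Nat.finite_of_card_ne_zero (by rw [h36]; norm_num)
    exact nonempty_mulEquiv_model h36 hZ h4
  · rintro ⟨e⟩
    exact invariants_of_mulEquiv e.symm model_invariants

end Recognition

/-- `3² : 4` is solvable (an extension of the abelian group `ℤ/4` by the abelian group `𝔽₃²`).
[folklore] -/
instance isSolvable_model : IsSolvable Model :=
  solvable_of_ker_le_range (SemidirectProduct.inl : V →* Model)
    (SemidirectProduct.rightHom : Model →* C4)
    (le_of_eq SemidirectProduct.range_inl_eq_ker_rightHom.symm)

end Hessian36

/-! ### Part 4: functoriality of the projective image -/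

section Functorial

variable {G : Type*} [Group G] {n : Type*} [Fintype n] [DecidableEq n] {R : Type*} [CommRing R]
  {m : Type*} [Fintype m] [DecidableEq m] {S : Type*} [CommRing S]

/-- If `f : GL_n(R) → GL_m(S)` descends to `F : PGL_n(R) → PGL_m(S)`, the projective image of
`f ∘ ρ` is `F` applied to the projective image of `ρ`. [folklore] -/
theorem projectiveImage_comp_eq_map (f : GL n R →* GL m S) (F : PGL(n, R) →* PGL(m, S))
    (hF : F.comp Matrix.ProjGenLinGroup.mk = Matrix.ProjGenLinGroup.mk.comp f) (ρ : G →* GL n R) :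
    projectiveImage (f.comp ρ) = (projectiveImage ρ).map F := by
  rw [projectiveImage, projectiveImage, ← MonoidHom.range_comp, ← MonoidHom.comp_assoc, ← hF,
    MonoidHom.comp_assoc]

/-- Under the hypotheses of `projectiveImage_comp_eq_map` with `F` injective, the projective
images of `ρ` and `f ∘ ρ` are isomorphic. [folklore] -/
noncomputable def projectiveImageCompEquiv (f : GL n R →* GL m S) (F : PGL(n, R) →* PGL(m, S))
    (hF : F.comp Matrix.ProjGenLinGroup.mk = Matrix.ProjGenLinGroup.mk.comp f)
    (hinj : Function.Injective F) (ρ : G →* GL n R) :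
    projectiveImage ρ ≃* projectiveImage (f.comp ρ) :=
  ((projectiveImage ρ).equivMapOfInjective F hinj).trans
    (MulEquiv.subgroupCongr (projectiveImage_comp_eq_map f F hF ρ).symm)

variable (n R) in
/-- The **contragredient** `g ↦ (g⁻¹)ᵀ = (gᵀ)⁻¹` on `GL_n(R)` as a group homomorphism (the
algebraic map underlying `glTransposeInv`, which additionally records continuity). [folklore] -/
def glContragredient : GL n R →* GL n R where
  toFun g :=
    ⟨((g⁻¹ : GL n R) : Matrix n n R)ᵀ, (g : Matrix n n R)ᵀ,
      by rw [← Matrix.transpose_mul]; simp, by rw [← Matrix.transpose_mul]; simp⟩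
  map_one' := Units.ext <| by simp
  map_mul' g h := Units.ext <| by simp [Matrix.transpose_mul, _root_.mul_inv_rev]

/-- Unfolding lemma for `glContragredient` (as a matrix). [folklore] -/
@[simp] theorem coe_glContragredient_apply (g : GL n R) :
    ((glContragredient n R g : GL n R) : Matrix n n R) = ((g⁻¹ : GL n R) : Matrix n n R)ᵀ :=
  rfl

/-- `glTransposeInv` is `glContragredient` with continuity. [folklore] -/
theorem toMonoidHom_glTransposeInv [TopologicalSpace R] :
    (glTransposeInv n R).toMonoidHom = glContragredient n R :=
  rfl

/-- The contragredient is an involution. [folklore] -/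
theorem glContragredient_glContragredient (g : GL n R) :
    glContragredient n R (glContragredient n R g) = g := by
  refine Units.ext ?_
  rw [coe_glContragredient_apply, ← map_inv, coe_glContragredient_apply, inv_inv,
    Matrix.transpose_transpose]

/-- The contragredient of a scalar matrix is the inverse scalar. [folklore] -/
theorem glContragredient_scalar (u : Rˣ) :
    glContragredient n R (Matrix.GeneralLinearGroup.scalar n u) =
      Matrix.GeneralLinearGroup.scalar n u⁻¹ := by
  refine Units.ext ?_
  rw [coe_glContragredient_apply, ← map_inv, Matrix.GeneralLinearGroup.coe_scalar,
    Matrix.scalar_apply, Matrix.diagonal_transpose]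

variable (n R) in
/-- The contragredient descends to `PGL_n(R)` (it maps scalars to scalars). [folklore] -/
def pglContragredient : PGL(n, R) →* PGL(n, R) :=
  Matrix.ProjGenLinGroup.lift (Matrix.ProjGenLinGroup.mk.comp (glContragredient n R)) <| by
    ext u
    simp only [MonoidHom.comp_apply, glContragredient_scalar, Matrix.ProjGenLinGroup.mk_scalar,
      MonoidHom.one_apply]

/-- `pglContragredient ∘ mk = mk ∘ glContragredient`. [folklore] -/
theorem pglContragredient_comp_mk :
    (pglContragredient n R).comp Matrix.ProjGenLinGroup.mk =
      Matrix.ProjGenLinGroup.mk.comp (glContragredient n R) :=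
  Matrix.ProjGenLinGroup.lift_comp_mk _

/-- `pglContragredient (mk g) = mk ((g⁻¹)ᵀ)`. [folklore] -/
@[simp] theorem pglContragredient_mk (g : GL n R) :
    pglContragredient n R (Matrix.ProjGenLinGroup.mk g) =
      Matrix.ProjGenLinGroup.mk (glContragredient n R g) :=
  rfl

/-- The projective contragredient is an involution, hence injective. [folklore] -/
theorem pglContragredient_injective : Function.Injective (pglContragredient n R) := by
  refine Function.Involutive.injective fun x => ?_
  induction x using Matrix.ProjGenLinGroup.induction_on with
  | mk g => rw [pglContragredient_mk, pglContragredient_mk, glContragredient_glContragredient]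

/-- The projective images of `ρ` and of its contragredient `g ↦ (ρ(g)⁻¹)ᵀ` are isomorphic.
[folklore] -/
noncomputable def projectiveImageContragredientEquiv (ρ : G →* GL n R) :
    projectiveImage ρ ≃* projectiveImage ((glContragredient n R).comp ρ) :=
  projectiveImageCompEquiv (glContragredient n R) (pglContragredient n R) pglContragredient_comp_mk
    pglContragredient_injective ρ

end Functorial

/-! ### Part 5: representations of Hessian `108`-type -/

section Types

variable {G : Type*} [Group G] {n : Type*} [Fintype n] [DecidableEq n] {R : Type*} [CommRing R]

/-- `ρ : G → GL_n(R)` is of **(Hessian) `108`-type**: its projective image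
`\bar ρ(G) ≤ PGL_n(R)` has order `36`, trivial centre, and an element of order `4` —
equivalently (`isHessian108Type_iff_nonempty_mulEquiv`) `\bar ρ(G)` is isomorphic to the
Frobenius group `3² : 4 = 𝔽₃² ⋊ ℤ/4` (`Hessian36.Model`, SmallGroup(36,9)), i.e. to `V ⋊ B` with
`V = 𝔽₃²` and `B ≤ SL₂(𝔽₃)` cyclic of order `4` in the notation of Lapid 1998, §5 (`q = 3`:
"`q`-dimensional irreducible representations whose image in `PGL_q(ℂ)` is isomorphic to
`𝔽_q × 𝔽_q ⋊ B` where `B ⊆ SL₂(𝔽_q)` is solvable and `q ∤ |B|`").  For an irreducible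
`ρ : G → GL₃(ℂ)` this is the smallest of the three primitive solvable types in dimension `3`:
the linear image in `SL₃(ℂ)` is then Blichfeldt's primitive group of order `108`, whence the
name (the others, of orders `216` and `648 = 3 · |Hessian group of order 216|`, have
projective images `3² : Q₈` and `3² : SL₂(𝔽₃)`).  Meaningful for `n = Fin 3`; stated for any
`n`.  The three intrinsic invariants are the form in which the route
`Summits/Langlands/Langlands/Theses/HessianFirstBlood` inlines the notion
(`isHessian108Type_iff` is `Iff.rfl`). [cite: Lapid1998, §5] -/
def IsHessian108Type (ρ : G →* GL n R) : Prop :=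
  Nat.card (projectiveImage ρ) = 36 ∧ Subgroup.center (projectiveImage ρ) = ⊥ ∧
    ∃ g : projectiveImage ρ, orderOf g = 4

/-- Unfolding lemma for `IsHessian108Type` (definitional, `Iff.rfl`): the form inlined by the
route `HessianFirstBlood`. [folklore] -/
theorem isHessian108Type_iff (ρ : G →* GL n R) :
    IsHessian108Type ρ ↔
      Nat.card (projectiveImage ρ) = 36 ∧ Subgroup.center (projectiveImage ρ) = ⊥ ∧
        ∃ g : projectiveImage ρ, orderOf g = 4 :=
  Iff.rfl

/-- **`108`-type ⇔ projective image `≅ 3² : 4`** (`Hessian36.invariants_iff_nonempty_mulEquiv_model`).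
[folklore] -/
theorem isHessian108Type_iff_nonempty_mulEquiv (ρ : G →* GL n R) :
    IsHessian108Type ρ ↔ Nonempty (projectiveImage ρ ≃* Hessian36.Model) :=
  Hessian36.invariants_iff_nonempty_mulEquiv_model

/-- `108`-type only depends on the isomorphism class of the projective image. [folklore] -/
theorem isHessian108Type_iff_of_mulEquiv {G' : Type*} [Group G'] {m : Type*} [Fintype m]
    [DecidableEq m] {S : Type*} [CommRing S] {ρ : G →* GL n R} {ρ' : G' →* GL m S}
    (e : projectiveImage ρ ≃* projectiveImage ρ') : IsHessian108Type ρ ↔ IsHessian108Type ρ' :=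
  ⟨Hessian36.invariants_of_mulEquiv e, Hessian36.invariants_of_mulEquiv e.symm⟩

/-- **Invariance under conjugation**: `P ρ P⁻¹` is of `108`-type iff `ρ` is. [folklore] -/
theorem isHessian108Type_conjGL_iff (P : GL n R) (ρ : G →* GL n R) :
    IsHessian108Type (conjGL P ρ) ↔ IsHessian108Type ρ :=
  (isHessian108Type_iff_of_mulEquiv (projectiveImageConjEquiv P ρ)).symm

/-- **Invariance under the contragredient**: `g ↦ (ρ(g)⁻¹)ᵀ` is of `108`-type iff `ρ` is.
[folklore] -/
theorem isHessian108Type_contragredient_iff (ρ : G →* GL n R) :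
    IsHessian108Type ((glContragredient n R).comp ρ) ↔ IsHessian108Type ρ :=
  (isHessian108Type_iff_of_mulEquiv (projectiveImageContragredientEquiv ρ)).symm

namespace IsHessian108Type

variable {ρ : G →* GL n R}

/-- The projective image of a `108`-type representation is finite (of order `36`). [folklore] -/
theorem finite_projectiveImage (h : IsHessian108Type ρ) : Finite (projectiveImage ρ) :=
  Nat.finite_of_card_ne_zero (by rw [h.1]; norm_num)

/-- `|\bar ρ(G)| = 36`. [folklore] -/
theorem card_projectiveImage (h : IsHessian108Type ρ) : Nat.card (projectiveImage ρ) = 36 :=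
  h.1

/-- `Z(\bar ρ(G)) = 1`. [folklore] -/
theorem center_projectiveImage (h : IsHessian108Type ρ) :
    Subgroup.center (projectiveImage ρ) = ⊥ :=
  h.2.1

/-- `\bar ρ(G)` has an element of order `4`. [folklore] -/
theorem exists_orderOf_eq_four (h : IsHessian108Type ρ) : ∃ g : projectiveImage ρ, orderOf g = 4 :=
  h.2.2

/-- `\bar ρ(G) ≅ 3² : 4`. [folklore] -/
theorem nonempty_mulEquiv_model (h : IsHessian108Type ρ) :
    Nonempty (projectiveImage ρ ≃* Hessian36.Model) :=
  (isHessian108Type_iff_nonempty_mulEquiv ρ).mp h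

/-- A representation whose projective image is isomorphic to `3² : 4` is of `108`-type.
[folklore] -/
theorem of_mulEquiv_model (e : projectiveImage ρ ≃* Hessian36.Model) : IsHessian108Type ρ :=
  (isHessian108Type_iff_nonempty_mulEquiv ρ).mpr ⟨e⟩

/-- **Structural form** (`Hessian36.order36Frobenius` applied to `\bar ρ(G)`): a `108`-type
projective image has a normal subgroup `N` of order `9` and exponent `3` (`N = 𝔽₃²`, the Sylow
`3`-subgroup), every element outside `N` has order `2` or `4`, and no non-trivial element of `N`
commutes with an element outside `N`. [folklore] -/
theorem exists_normal_subgroup (h : IsHessian108Type ρ) :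
    ∃ N : Subgroup (projectiveImage ρ), N.Normal ∧ Nat.card N = 9 ∧ (∀ x ∈ N, x ^ 3 = 1) ∧
      (∀ g : projectiveImage ρ, g ∉ N → orderOf g = 2 ∨ orderOf g = 4) ∧
        ∀ g : projectiveImage ρ, g ∉ N → ∀ x ∈ N, g * x = x * g → x = 1 := by
  haveI := h.finite_projectiveImage
  exact Hessian36.order36Frobenius _ h.1 h.2.1 h.2.2

/-- A `108`-type representation has solvable projective image. [folklore] -/
theorem isSolvable_projectiveImage (h : IsHessian108Type ρ) : IsSolvable (projectiveImage ρ) := by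
  obtain ⟨e⟩ := h.nonempty_mulEquiv_model
  exact solvable_of_surjective (f := e.symm.toMonoidHom) e.symm.surjective

/-- A `108`-type representation has solvable image (`isSolvable_projectiveImage_iff`). [folklore] -/
theorem isSolvable_range (h : IsHessian108Type ρ) : IsSolvable ρ.range :=
  (isSolvable_projectiveImage_iff ρ).mp h.isSolvable_projectiveImage

/-- `108`-type is preserved by conjugation. [folklore] -/
theorem conjGL (h : IsHessian108Type ρ) (P : GL n R) : IsHessian108Type (conjGL P ρ) :=
  (isHessian108Type_conjGL_iff P ρ).mpr h

/-- `108`-type is preserved by the contragredient. [folklore] -/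
theorem contragredient (h : IsHessian108Type ρ) :
    IsHessian108Type ((glContragredient n R).comp ρ) :=
  (isHessian108Type_contragredient_iff ρ).mpr h

end IsHessian108Type

end Types

/-! ### Part 6: framed continuous representations (`FramedRep.dual`, `FramedRep.conj`) -/

section Framed

variable {G : Type*} [Group G] [TopologicalSpace G] {A : Type*} [CommRing A] [TopologicalSpace A]
  {m : ℕ}

/-- The group homomorphism underlying the dual framed representation is the contragredient of
the underlying homomorphism. [folklore] -/
theorem FramedRep.toMonoidHom_dual_eq_contragredient_comp (ρ : FramedRep G A m) :
    (FramedRep.dual ρ).toMonoidHom = (glContragredient (Fin m) A).comp ρ.toMonoidHom :=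
  rfl

/-- The group homomorphism underlying a conjugated framed representation. [folklore] -/
theorem FramedRep.toMonoidHom_conj_eq_conjGL [IsTopologicalRing A] (P : GL (Fin m) A)
    (ρ : FramedRep G A m) : (ρ.conj P).toMonoidHom = conjGL P ρ.toMonoidHom :=
  rfl

/-- **`108`-type is invariant under `FramedRep.dual`.** [folklore] -/
theorem FramedRep.isHessian108Type_dual_iff (ρ : FramedRep G A m) :
    IsHessian108Type (FramedRep.dual ρ).toMonoidHom ↔ IsHessian108Type ρ.toMonoidHom := by
  rw [FramedRep.toMonoidHom_dual_eq_contragredient_comp]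
  exact isHessian108Type_contragredient_iff _

/-- **`108`-type is invariant under `FramedRep.conj`.** [folklore] -/
theorem FramedRep.isHessian108Type_conj_iff [IsTopologicalRing A] (P : GL (Fin m) A)
    (ρ : FramedRep G A m) :
    IsHessian108Type (ρ.conj P).toMonoidHom ↔ IsHessian108Type ρ.toMonoidHom := by
  rw [FramedRep.toMonoidHom_conj_eq_conjGL]
  exact isHessian108Type_conjGL_iff P _

end Framed

/-! ### Part 7: the companion types (projective images `3² : Q₈` and `3² : SL₂(𝔽₃)`) -/

namespace Hessian36

section SLAction

/-- The natural (left) action of `A ∈ SL₂(𝔽₃)` on column vectors of `𝔽₃² = ZMod 3 × ZMod 3`: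
`(a, b) ↦ (A₀₀ a + A₀₁ b, A₁₀ a + A₁₁ b)`, an additive automorphism (the inverse is given by the
adjugate since `det A = 1`). [folklore] -/
def slAddAut (A : SL(2, ZMod 3)) : ZMod 3 × ZMod 3 ≃+ ZMod 3 × ZMod 3 where
  toFun p := (A 0 0 * p.1 + A 0 1 * p.2, A 1 0 * p.1 + A 1 1 * p.2)
  invFun p := (A 1 1 * p.1 - A 0 1 * p.2, -A 1 0 * p.1 + A 0 0 * p.2)
  left_inv p := by
    have hdet : A 0 0 * A 1 1 - A 0 1 * A 1 0 = 1 := by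
      rw [← Matrix.det_fin_two]
      exact A.det_coe
    refine Prod.ext ?_ ?_
    · dsimp only
      linear_combination p.1 * hdet
    · dsimp only
      linear_combination p.2 * hdet
  right_inv p := by
    have hdet : A 0 0 * A 1 1 - A 0 1 * A 1 0 = 1 := by
      rw [← Matrix.det_fin_two]
      exact A.det_coe
    refine Prod.ext ?_ ?_
    · dsimp only
      linear_combination p.1 * hdet
    · dsimp only
      linear_combination p.2 * hdet
  map_add' p q := Prod.ext (by dsimp only [Prod.fst_add, Prod.snd_add]; ring)
    (by dsimp only [Prod.fst_add, Prod.snd_add]; ring)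

/-- Unfolding lemma for `slAddAut`. [folklore] -/
@[simp] theorem slAddAut_apply (A : SL(2, ZMod 3)) (p : ZMod 3 × ZMod 3) :
    slAddAut A p = (A 0 0 * p.1 + A 0 1 * p.2, A 1 0 * p.1 + A 1 1 * p.2) :=
  rfl

/-- `slAddAut 1 = id`. [folklore] -/
theorem slAddAut_one (p : ZMod 3 × ZMod 3) : slAddAut 1 p = p := by
  rw [slAddAut_apply]
  refine Prod.ext ?_ ?_ <;>
    simp [Matrix.SpecialLinearGroup.coe_one, Matrix.one_apply_eq, Matrix.one_apply_ne]

/-- `slAddAut (A B) = slAddAut A ∘ slAddAut B`. [folklore] -/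
theorem slAddAut_mul (A B : SL(2, ZMod 3)) (p : ZMod 3 × ZMod 3) :
    slAddAut (A * B) p = slAddAut A (slAddAut B p) := by
  simp only [slAddAut_apply, Matrix.SpecialLinearGroup.coe_mul, Matrix.mul_apply,
    Fin.sum_univ_two]
  refine Prod.ext ?_ ?_ <;> dsimp only <;> ring

/-- **The natural action `SL₂(𝔽₃) → Aut(V)`** on `V = 𝔽₃²` (written multiplicatively).
[folklore] -/
def slAction : SL(2, ZMod 3) →* MulAut V where
  toFun A := AddEquiv.toMultiplicative (slAddAut A)
  map_one' := MulEquiv.ext fun v => congrArg Multiplicative.ofAdd (slAddAut_one (Multiplicative.toAdd v))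
  map_mul' A B := MulEquiv.ext fun v =>
    congrArg Multiplicative.ofAdd (slAddAut_mul A B (Multiplicative.toAdd v))

/-- Unfolding lemma for `slAction`. [folklore] -/
@[simp] theorem slAction_ofAdd (A : SL(2, ZMod 3)) (p : ZMod 3 × ZMod 3) :
    slAction A (Multiplicative.ofAdd p) =
      Multiplicative.ofAdd (A 0 0 * p.1 + A 0 1 * p.2, A 1 0 * p.1 + A 1 1 * p.2) :=
  rfl

/-- The quarter-turn matrix `[[0, -1], [1, 0]] ∈ SL₂(𝔽₃)` (order `4`). [folklore] -/
def rotSL : SL(2, ZMod 3) :=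
  ⟨!![0, -1; 1, 0], by rw [Matrix.det_fin_two_of]; ring⟩

/-- The quarter-turn `rot` of the `108`-model is the action of `rotSL ∈ SL₂(𝔽₃)`: the model
`3² : 4` is `V ⋊ B` for the cyclic subgroup `B = ⟨rotSL⟩ ≤ SL₂(𝔽₃)` of order `4`
(Lapid 1998, §5, `q = 3`). [folklore] -/
theorem slAction_rotSL : slAction rotSL = rot := by
  refine MulEquiv.ext fun v => ?_
  obtain ⟨p, rfl⟩ : ∃ p, Multiplicative.ofAdd p = v := ⟨Multiplicative.toAdd v, rfl⟩
  rw [slAction_ofAdd, rot_ofAdd]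
  simp [rotSL]

/-- `rotSL` has order `4` in `SL₂(𝔽₃)`. [folklore] -/
theorem orderOf_rotSL : orderOf rotSL = 4 := by
  have h4 : rotSL ^ 2 ^ (1 + 1) = 1 := by decide
  have h2 : ¬ rotSL ^ 2 ^ 1 = 1 := by decide
  simpa using orderOf_eq_prime_pow h2 h4

/-- **The model `3² : SL₂(𝔽₃)`** (order `216`): `V ⋊ SL₂(𝔽₃)` for the natural action — the
projective image of the `648`-type (the Hessian group of order `216`, Coxeter–Moser §7.7, is
this group; its linear preimage in `SL₃(ℂ)` has order `648`). [folklore] -/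
abbrev Model648 : Type := V ⋊[slAction] SL(2, ZMod 3)

/-- For a subgroup `B ≤ SL₂(𝔽₃)`, the group `V ⋊ B` (Lapid 1998, §5: `q = 3`). [folklore] -/
abbrev ModelSub (B : Subgroup SL(2, ZMod 3)) : Type := V ⋊[slAction.comp B.subtype] B

/-- `|V ⋊ B| = 9 · |B|`. [folklore] -/
theorem card_modelSub (B : Subgroup SL(2, ZMod 3)) : Nat.card (ModelSub B) = 9 * Nat.card B := by
  rw [SemidirectProduct.card, Nat.card_congr Multiplicative.toAdd, Nat.card_prod, Nat.card_zmod]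

end SLAction

end Hessian36

section CompanionTypes

variable {G : Type*} [Group G] {n : Type*} [Fintype n] [DecidableEq n] {R : Type*} [CommRing R]

/-- `ρ` is of **(Hessian) `216`-type**: its projective image is isomorphic to `V ⋊ Q` with
`V = 𝔽₃²` and `Q` a (the) Sylow `2`-subgroup of `SL₂(𝔽₃)` (`Q ≅ Q₈`, normal, so the choice is
immaterial), i.e. to `3² : Q₈ ≅ PSU₃(2)` of order `72` — Lapid 1998, §5 with `q = 3`,
`B = Q₈`; the linear image of an irreducible `ρ : G → GL₃(ℂ)` of this type in `SL₃(ℂ)` is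
Blichfeldt's primitive group of order `216`. Definition only (companion of `IsHessian108Type`).
[cite: Lapid1998, §5] -/
def IsHessian216Type (ρ : G →* GL n R) : Prop :=
  ∃ Q : Sylow 2 SL(2, ZMod 3),
    Nonempty (projectiveImage ρ ≃* Hessian36.ModelSub (Q : Subgroup SL(2, ZMod 3)))

/-- `ρ` is of **(Hessian) `648`-type**: its projective image is isomorphic to
`3² : SL₂(𝔽₃) = V ⋊ SL₂(𝔽₃)` (the Hessian group of order `216`; `B = SL₂(𝔽₃)` in Lapid's
notation, here `3 ∣ |B|`); the linear image of an irreducible `ρ : G → GL₃(ℂ)` of this type in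
`SL₃(ℂ)` is the primitive group of order `648`. Definition only (companion of
`IsHessian108Type`). [folklore] -/
def IsHessian648Type (ρ : G →* GL n R) : Prop :=
  Nonempty (projectiveImage ρ ≃* Hessian36.Model648)

/-- Unfolding lemma for `IsHessian216Type`. [folklore] -/
theorem isHessian216Type_iff (ρ : G →* GL n R) :
    IsHessian216Type ρ ↔ ∃ Q : Sylow 2 SL(2, ZMod 3),
      Nonempty (projectiveImage ρ ≃* Hessian36.ModelSub (Q : Subgroup SL(2, ZMod 3))) :=
  Iff.rfl

/-- Unfolding lemma for `IsHessian648Type`. [folklore] -/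
theorem isHessian648Type_iff (ρ : G →* GL n R) :
    IsHessian648Type ρ ↔ Nonempty (projectiveImage ρ ≃* Hessian36.Model648) :=
  Iff.rfl

/-- `216`-type only depends on the isomorphism class of the projective image. [folklore] -/
theorem isHessian216Type_iff_of_mulEquiv {G' : Type*} [Group G'] {m : Type*} [Fintype m]
    [DecidableEq m] {S : Type*} [CommRing S] {ρ : G →* GL n R} {ρ' : G' →* GL m S}
    (e : projectiveImage ρ ≃* projectiveImage ρ') : IsHessian216Type ρ ↔ IsHessian216Type ρ' :=
  ⟨fun ⟨Q, ⟨f⟩⟩ => ⟨Q, ⟨e.symm.trans f⟩⟩, fun ⟨Q, ⟨f⟩⟩ => ⟨Q, ⟨e.trans f⟩⟩⟩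

/-- `648`-type only depends on the isomorphism class of the projective image. [folklore] -/
theorem isHessian648Type_iff_of_mulEquiv {G' : Type*} [Group G'] {m : Type*} [Fintype m]
    [DecidableEq m] {S : Type*} [CommRing S] {ρ : G →* GL n R} {ρ' : G' →* GL m S}
    (e : projectiveImage ρ ≃* projectiveImage ρ') : IsHessian648Type ρ ↔ IsHessian648Type ρ' :=
  ⟨fun ⟨f⟩ => ⟨e.symm.trans f⟩, fun ⟨f⟩ => ⟨e.trans f⟩⟩

/-- `216`-type is invariant under conjugation. [folklore] -/
theorem isHessian216Type_conjGL_iff (P : GL n R) (ρ : G →* GL n R) :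
    IsHessian216Type (conjGL P ρ) ↔ IsHessian216Type ρ :=
  (isHessian216Type_iff_of_mulEquiv (projectiveImageConjEquiv P ρ)).symm

/-- `648`-type is invariant under conjugation. [folklore] -/
theorem isHessian648Type_conjGL_iff (P : GL n R) (ρ : G →* GL n R) :
    IsHessian648Type (conjGL P ρ) ↔ IsHessian648Type ρ :=
  (isHessian648Type_iff_of_mulEquiv (projectiveImageConjEquiv P ρ)).symm

/-- `216`-type is invariant under the contragredient. [folklore] -/
theorem isHessian216Type_contragredient_iff (ρ : G →* GL n R) :
    IsHessian216Type ((glContragredient n R).comp ρ) ↔ IsHessian216Type ρ :=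
  (isHessian216Type_iff_of_mulEquiv (projectiveImageContragredientEquiv ρ)).symm

/-- `648`-type is invariant under the contragredient. [folklore] -/
theorem isHessian648Type_contragredient_iff (ρ : G →* GL n R) :
    IsHessian648Type ((glContragredient n R).comp ρ) ↔ IsHessian648Type ρ :=
  (isHessian648Type_iff_of_mulEquiv (projectiveImageContragredientEquiv ρ)).symm

end CompanionTypes

end Literature.NumberTheory.GaloisRepresentations
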